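import Summits.ResolutionOfSingularities.ResolutionOfSingularities.Theorems.HomologicalConductorNoZenoSelfIntersectionNonpos
import Literature.AlgebraicGeometry.Resolution.ExceptionalFibreConnected
import Literature.AlgebraicGeometry.Resolution.Lipman1969IntersectionPositivityHolds
import Mathlib.RingTheory.Ideal.KrullsHeightTheorem
import HarnessLib

/-!
# Crux `NoZenoR` (stmt-ResolutionOfSingularities-19943), facts slot: `(E_η²) < 0` FACT-FREE —
# Lipman's Lemma (14.1) at a single integral exceptional curve is a THEOREM

Route `ResolutionOfSingularities/HomologicalConductor` (cell decomp-res, hand leafhand-res-homologicalconduct-7 g0).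
OURS: AI-written, weaker than expert review; nothing here is a statement of the manuscript under review (Hironaka 2017).
Def-free, FACT-FREE (the only Lipman statement used, (13.1) c), is the tree THEOREM `Lipman1969_13_1_c_holds`).

Companion of `…NoZenoSelfIntersectionNonpos` (p811936, `(E_η²) ≤ 0`).  Here the STRICT inequality: for a desingularization
`π : X → Spec S` of a two-dimensional normal Noetherian local domain and `η ∈ excCurvePoints π`, **`(E_η · E_η) < 0`** — the
`1 × 1` case of the negative definiteness of the intersection matrix (Lipman 1969 Lemma (14.1); Mumford; du Val), i.e. the
typed named fact `Lipman1969_14_1` at the one-element family `{η}`.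

Proof.  As in the companion file, with `0 ≠ f ∈ 𝔪_S`, `P = div(π^*f)`, `a = ord_η P ≥ 1`, `e = ord_η[E_η] ≥ 1`, the divisor
`D' = e·P − a·[E_η]` is effective, avoids `η`, and `0 = (D'·E_η) + a·(E_η²)`.  It remains to see `(D'·E_η) ≠ 0`, i.e.
((13.1) c), tree theorem) that `D'` does NOT avoid every point of `E_η`.  If it did: (A) at a point `x` off `E_η` avoided by
`D'`, also `[E_η]` avoids `x`, so `e·P ∼ D' + a·[E_η]` avoids `x` and `f ∉ π(x)`; (B) the closed fibre `π⁻¹(𝔪)` is connected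
(Zariski, tree `IsResolution.isPreconnected_closedFibre`) and covered by the open `{D' avoids}` and the open complement of
`E_η`, whose traces cannot meet by (A) (`f ∈ 𝔪`) — so `π⁻¹(𝔪) ⊆ E_η`; (C) by Krull's principal ideal theorem some prime
`𝔭 ∋ f` has height `≤ 1 < 2 = ht 𝔪`; a point `y` of `X` over `𝔭` (`π` is onto) specialises to a point `c` over `𝔪`, so
`c ∈ E_η`, `D'` avoids `c`, hence avoids `y` (avoidance is stable under generisation), and `y ∉ E_η` (it lies over
`𝔭 ≠ 𝔪`) — so by (A) `f ∉ 𝔭`, a contradiction.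

* `excCurveDegree_self_neg_factFree` — the statement (universe `0`).
* `lipman1969_14_1_singleton` — the same in the binder shape of `Lipman1969_14_1` restricted to one-element families
  (`F = {η}`, any non-zero `y`): `Σ Σ y_i y_j (E_j·E_i) < 0`.

Consequence for the W3 print-debt census: `(E²) ≤ −h⁰(E)`, `3·h⁰(𝓘_η) ≤ h⁰(𝓘_η²)` and Lipman (27.3) «⇒» now rest on
`Lipman1969_13_1_d_rat` (+ `Lipman1969_27_1_reg_rat` for the last) ONLY — see the appendix of `…NoZenoSelfIntersectionBound`.
-/

noncomputable section

-- single-problem summit: the doubled namespace component `ResolutionOfSingularities` is forced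
set_option linter.dupNamespace false

namespace Summit.ResolutionOfSingularities.ResolutionOfSingularities.Theorems.NoZeno.ExcCount

open CategoryTheory AlgebraicGeometry TopologicalSpace IsLocalRing Order
open Literature.AlgebraicGeometry.Resolution Literature.AlgebraicGeometry.Motives
open Literature.AlgebraicGeometry.Motives.RatFn

/-- **`(E_η · E_η) < 0` for every integral exceptional curve of a desingularization of a two-dimensional normal Noetherian
local domain — FACT-FREE** (Lipman's Lemma (14.1) for one curve; proof in the module docstring: decomposition
`e·div(π^*f) = D' + a·[E_η]`, positivity `(D'·E_η) > 0` from (13.1) c) (tree theorem) via Zariski connectedness of the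
closed fibre and Krull's principal ideal theorem). [cite: Lipman1969, Lemma (14.1) (p. 224)] -/
theorem excCurveDegree_self_neg_factFree {S : Type} [CommRing S] [IsNoetherianRing S] [IsLocalRing S] [IsDomain S]
    [IsIntegrallyClosed S] (h2 : ringKrullDim S = 2) {X : Scheme.{0}} {π : X ⟶ Spec (.of S)} [IsIntegral X]
    [IsLocallyNoetherian X] (hπ : IsResolution π) {η : X} (hη : η ∈ excCurvePoints π)
    (hc : IsEffectiveCartier (primeDivisorIdeal η)) :
    excCurveDegree π (CartierDivisor.ofIsEffectiveCartier (primeDivisorIdeal η) hc) η < 0 := by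
  classical
  haveI : IsProper π := hπ.isProper
  have hX : Scheme.IsRegular X := hπ.isRegular
  -- a non-zero element of the maximal ideal (`S` is not a field: `dim S = 2`)
  have hm : maximalIdeal S ≠ ⊥ := by
    intro h
    have h0 := ringKrullDim_eq_zero_of_isField (IsLocalRing.isField_iff_maximalIdeal_eq.mpr h)
    rw [h2] at h0
    exact absurd h0 (by decide)
  obtain ⟨f, hfm, hf0⟩ := Submodule.exists_mem_ne_zero_of_ne_bot hm
  -- the principal divisor `P = div(π^* f)`: effective, of positive order along `E_η`, degree `0` on `E_η`
  have hφ0 : baseToFunctionField π f ≠ 0 := fun h =>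
    hf0 (NoZeno.SandwichCluster.LemmaL.baseToFunctionField_injective π hπ (by rw [h, map_zero]))
  set P : CartierDivisor X := CartierDivisor.principal (baseToFunctionField π f) hφ0 with hPdef
  have hPeff : P.IsEffective := fun _ y _ => NoZeno.SandwichCluster.isRegularAt_baseToFunctionField π y f
  have hcoη : coheight η = 1 := hπ.coheight_eq_one_of_mem_excCurvePoints h2 hη
  have hPη : ¬ IsUnitAt η (P.f PUnit.unit) := by
    change ¬ IsUnitAt η (baseToFunctionField π f)
    rw [isUnitAt_baseToFunctionField_iff, not_not, hη.1]
    exact hfm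
  have ha : 0 < P.ordAt η := hPeff.ordAt_pos (i := PUnit.unit) trivial hPη hcoη
  -- the prime divisor `E = [E_η]`: effective, positive order at `η`, order `0` at every other codimension-one point
  set E : CartierDivisor X := CartierDivisor.ofIsEffectiveCartier (primeDivisorIdeal η) hc with hEdef
  have hEeff : E.IsEffective := CartierDivisor.isEffective_ofIsEffectiveCartier _ hc
  have hEav : ∀ z : X, ¬ η ⤳ z → E.Avoids z := fun z hz =>
    (CartierDivisor.avoids_ofIsEffectiveCartier_iff _ hc z).2 (by rwa [mem_support_primeDivisorIdeal_iff])
  have hEη : ¬ E.Avoids η := fun h =>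
    (CartierDivisor.avoids_ofIsEffectiveCartier_iff _ hc η).1 h ((mem_support_primeDivisorIdeal_iff η η).2 le_rfl)
  have he : 0 < E.ordAt η := by
    simp only [CartierDivisor.Avoids, not_forall] at hEη
    obtain ⟨i, hi, hu⟩ := hEη
    exact hEeff.ordAt_pos hi hu hcoη
  -- codimension-one points other than `η` lie off `E_η`
  have hoff : ∀ z : X, coheight z = 1 → z ≠ η → E.ordAt z = 0 := by
    intro z hz hzη
    refine (hEav z fun hsp => ?_).ordAt_eq_zero
    -- `z` a proper specialisation of `η` would have coheight `≥ 2`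
    have hlt : z < η := ⟨Scheme.le_iff_specializes.2 hsp,
      fun h' => hzη ((Scheme.le_iff_specializes.1 h').antisymm hsp).eq⟩
    have h1 := Order.coheight_add_one_le hlt
    rw [hcoη, hz] at h1
    exact absurd h1 (by decide)
  -- `D' = e·P − a·E`
  set aN : ℕ := (P.ordAt η).toNat with haN
  set eN : ℕ := (E.ordAt η).toNat with heN
  have haZ : (aN : ℤ) = P.ordAt η := Int.toNat_of_nonneg ha.le
  have heZ : (eN : ℤ) = E.ordAt η := Int.toNat_of_nonneg he.le
  set D' : CartierDivisor X := eN • P + -(aN • E) with hD'def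
  have hD'ord : ∀ z : X, D'.ordAt z = eN * P.ordAt z - aN * E.ordAt z := by
    intro z
    rw [hD'def, CartierDivisor.ordAt_add, CartierDivisor.ordAt_neg, CartierDivisor.ordAt_smul,
      CartierDivisor.ordAt_smul]
    ring
  have hD'η : D'.ordAt η = 0 := by
    rw [hD'ord, ← haZ, ← heZ]; ring
  have hD'eff : D'.IsEffective := by
    refine CartierDivisor.isEffective_of_forall_ordAt_nonneg hX fun z hz => ?_
    by_cases hzη : z = η
    · rw [hzη, hD'η]
    · rw [hD'ord, hoff z hz hzη, mul_zero, sub_zero]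
      exact mul_nonneg (Nat.cast_nonneg _) (hPeff.ordAt_nonneg z)
  have hD'av : D'.Avoids η := hD'eff.avoids_of_ordAt_eq_zero hcoη hD'η
  have hD'deg : 0 ≤ excCurveDegree π D' η := excCurveDegree_nonneg_of_isEffective π hη hD'eff hD'av
  -- `e·P` and `D' + a·E` define the same divisor
  have hsame : (eN • P).SameDivisor (D' + aN • E) :=
    CartierDivisor.sameDivisor_of_forall_ordAt_eq hX fun z _ => by
      rw [CartierDivisor.ordAt_add, hD'ord, CartierDivisor.ordAt_smul, CartierDivisor.ordAt_smul]
      ring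
  have hdeg : (eN : ℤ) * excCurveDegree π P η = excCurveDegree π D' η + aN * excCurveDegree π E η := by
    rw [← excCurveDegree_smul π hη, excCurveDegree_congr_linEquiv π hη hsame.linEquiv,
      excCurveDegree_add π hη, excCurveDegree_smul π hη]
  rw [hPdef, excCurveDegree_principal π hη hφ0, mul_zero] at hdeg
  -- `(D'·E_η) ≥ 0`, `a ≥ 1`; it suffices that `(D'·E_η) ≠ 0`
  have haN0 : 0 < (aN : ℤ) := by rw [haZ]; exact ha
  have heN0 : 0 < eN := by
    have := he; rw [← heZ] at this; exact_mod_cast this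
  suffices hD'ne : excCurveDegree π D' η ≠ 0 by
    have hD'pos : 0 < excCurveDegree π D' η := lt_of_le_of_ne hD'deg (Ne.symm hD'ne)
    by_contra hnn
    have hEnn : 0 ≤ excCurveDegree π E η := not_lt.mp hnn
    have := mul_nonneg haN0.le hEnn
    linarith
  intro hzero
  -- (13.1) c) (tree theorem): `D'` avoids every point of `E_η`
  have hall : ∀ x ∈ closure ({η} : Set X), D'.Avoids x :=
    ((Lipman1969_13_1_c_holds S X π hπ.isProper hX D' hD'eff η hη hD'av).2).1 hzero
  -- (A) off the curve, avoidance by `D'` makes `f` a unit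
  have hstepA : ∀ x : X, D'.Avoids x → ¬ η ⤳ x → f ∉ (π.base x).asIdeal := by
    intro x hx hηx hfx
    have h1 : (D' + aN • E).Avoids x := hx.add ((hEav x hηx).smul aN)
    have h2 : (eN • P).Avoids x := hsame.symm.avoids h1
    have h3 : IsUnitAt x (baseToFunctionField π (f ^ eN)) := by
      rw [map_pow]
      exact h2 PUnit.unit trivial
    rw [isUnitAt_baseToFunctionField_iff] at h3
    exact h3 (Ideal.pow_mem_of_mem _ hfx eN heN0)
  -- (B) the closed fibre lies inside `E_η` (Zariski connectedness)
  have hF : π.base ⁻¹' {closedPoint S} ⊆ closure ({η} : Set X) := by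
    intro x hx
    by_contra hxη
    have hpre := hπ.isPreconnected_closedFibre
    have hUo : IsOpen (D'.nonvanishing 1) := D'.isOpen_nonvanishing 1
    have hVo : IsOpen (closure ({η} : Set X))ᶜ := isClosed_closure.isOpen_compl
    have hcover : π.base ⁻¹' {closedPoint S} ⊆ D'.nonvanishing 1 ∪ (closure ({η} : Set X))ᶜ := fun y _ => by
      by_cases hyc : y ∈ closure ({η} : Set X)
      · exact Or.inl (CartierDivisor.avoids_iff_mem_nonvanishing_one.1 (hall y hyc))
      · exact Or.inr hyc
    have hUne : (π.base ⁻¹' {closedPoint S} ∩ D'.nonvanishing 1).Nonempty :=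
      ⟨η, hη.1, CartierDivisor.avoids_iff_mem_nonvanishing_one.1 hD'av⟩
    have hVne : (π.base ⁻¹' {closedPoint S} ∩ (closure ({η} : Set X))ᶜ).Nonempty := ⟨x, hx, hxη⟩
    obtain ⟨y, hyF, hyU, hyV⟩ := hpre _ _ hUo hVo hcover hUne hVne
    have hyav : D'.Avoids y := CartierDivisor.avoids_iff_mem_nonvanishing_one.2 hyU
    have hηy : ¬ η ⤳ y := fun h => hyV (specializes_iff_mem_closure.1 h)
    have hfy := hstepA y hyav hηy
    have hyF' : π.base y = closedPoint S := hyF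
    rw [hyF'] at hfy
    exact hfy hfm
  -- (C) a prime `𝔭 ∋ f` of height `≤ 1`, hence `≠ 𝔪`
  obtain ⟨p, hp, -⟩ := Ideal.exists_minimalPrimes_le
    (show Ideal.span {f} ≤ maximalIdeal S from (Ideal.span_singleton_le_iff_mem _).2 hfm)
  have hpprime : p.IsPrime := hp.1.1
  have hfp : f ∈ p := hp.1.2 (Ideal.subset_span (Set.mem_singleton f))
  have hpm : p ≠ maximalIdeal S := by
    intro hpm
    have hh := Ideal.height_le_one_of_isPrincipal_of_mem_minimalPrimes (Ideal.span {f}) p hp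
    have hm2 : (maximalIdeal S).height = 2 := by
      have h := IsLocalRing.maximalIdeal_height_eq_ringKrullDim (R := S)
      rw [h2] at h
      exact WithBot.coe_eq_coe.mp (h.trans (WithBot.coe_ofNat 2).symm)
    rw [hpm, hm2] at hh
    exact absurd hh (by decide)
  -- a point `y` over `𝔭`, and a specialisation `c` of `y` over `𝔪`
  haveI : IsDominant π := hπ.isBirational.isDominant
  obtain ⟨y, hy⟩ := surjective_base_of_isProper π ⟨p, hpprime⟩
  have hclosed : IsClosed (π.base '' closure ({y} : Set X)) := π.isClosedMap _ isClosed_closure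
  have hmem : closedPoint S ∈ π.base '' closure ({y} : Set X) :=
    (IsLocalRing.specializes_closedPoint (⟨p, hpprime⟩ : PrimeSpectrum S)).mem_closed hclosed
      ⟨y, subset_closure (Set.mem_singleton y), hy⟩
  obtain ⟨c, hccl, hcm⟩ := hmem
  have hyc : y ⤳ c := specializes_iff_mem_closure.2 hccl
  have hcη : c ∈ closure ({η} : Set X) := hF hcm
  have hD'y : D'.Avoids y := (hall c hcη).of_specializes hyc
  have hηy : ¬ η ⤳ y := by
    intro h
    have hym : π.base y = closedPoint S := base_eq_closedPoint_of_specializes π hη.1 h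
    rw [hy] at hym
    exact hpm (congrArg PrimeSpectrum.asIdeal hym)
  have hfy := hstepA y hD'y hηy
  rw [hy] at hfy
  exact hfy hfp

/-- **Lipman (14.1) at one-element families, FACT-FREE** — the typed named fact `Lipman1969_14_1` (negative definiteness of
`((E_i·E_j))`) restricted to `F = {η}` (universe `0`): for every non-zero `y : F → ℤ`,
`Σ_i Σ_j y_i y_j (E_j·E_i) = y_η² · (E_η²) < 0`. [cite: Lipman1969, Lemma (14.1) (p. 224)] -/
theorem lipman1969_14_1_singleton {S : Type} [CommRing S] [IsNoetherianRing S] [IsLocalRing S] [IsDomain S]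
    [IsIntegrallyClosed S] (h2 : ringKrullDim S = 2) {X : Scheme.{0}} [IsIntegral X] [IsLocallyNoetherian X]
    {π : X ⟶ Spec (.of S)} (hπ : IsResolution π) {η : X} (hη : η ∈ excCurvePoints π)
    (hcF : ∀ x ∈ ({η} : Finset X), IsEffectiveCartier (primeDivisorIdeal x)) (y : {x // x ∈ ({η} : Finset X)} → ℤ)
    (hy : y ≠ 0) :
    ∑ i, ∑ j, y i * y j *
      excCurveDegree π (CartierDivisor.ofIsEffectiveCartier (primeDivisorIdeal (j : X)) (hcF j j.2)) i < 0 := by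
  have hsingle : ∀ (g : {x // x ∈ ({η} : Finset X)} → ℤ),
      ∑ i, g i = g ⟨η, Finset.mem_singleton_self η⟩ := fun g =>
    Fintype.sum_eq_single _ fun i hi => (hi (Subtype.ext (Finset.mem_singleton.1 i.2))).elim
  rw [hsingle, hsingle]
  have hneg := excCurveDegree_self_neg_factFree h2 hπ hη (hcF η (Finset.mem_singleton_self η))
  have hy0 : y ⟨η, Finset.mem_singleton_self η⟩ ≠ 0 := by
    intro h0
    apply hy
    funext i
    have hi : i = ⟨η, Finset.mem_singleton_self η⟩ := Subtype.ext (Finset.mem_singleton.1 i.2)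
    rw [hi, h0]
    rfl
  have hsq : 0 < y ⟨η, Finset.mem_singleton_self η⟩ * y ⟨η, Finset.mem_singleton_self η⟩ :=
    mul_self_pos.2 hy0
  simpa using mul_neg_of_pos_of_neg hsq hneg

end Summit.ResolutionOfSingularities.ResolutionOfSingularities.Theorems.NoZeno.ExcCount

end
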